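import Summits.AtomisticToContinuum.FouriersLaw.Theorems.PhononMeanFreePathDefs
import Summits.AtomisticToContinuum.FouriersLaw.Theorems.PhononMeanFreePathIncoherentChannelCommonPastBoundHelper1

/-!
# `stub_commonPastBound`, helper 2/2: the mean forecast `v_t = K_t p_N` — measurability, Gibbs moments, Cauchy–Schwarz

Support file (`--supports stmt-AtomisticToContinuum-11811`, registered helper
`commonPastBound_forecastDictionary`) for stub `stub_commonPastBound` of the line
`two-horizons-forecast-loss` of crux `PhononMeanFreePath.IncoherentChannel`, over the route vocabulary of
`PhononMeanFreePathDefs` (`fcast`, `fnorm`, `pairCorr`, `commonPast`): `(N+1)`-site pinned chain, both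
baths at `T`, `μ_T = gibbsMeasure (N+1) T`, `K_t = transitionKernel (N+1) T T t⁺`, `v_t = K_t p_N`
(`fcast`), `S_N(t) = ∫ v_t² dμ_T` (`fnorm`), `r_N(t) = ∫ p_0 v_t dμ_T` (`pairCorr`),
`P_N(t) = Cov_{μ_T}(p_0², v_t²)` (`commonPast`).

* `commonPastBound_measurable_fcast`: `(t, z) ↦ v_t(z)` is jointly measurable — by
  `P^t g(x) = E g(Φ_t(x, B))` (`pinnedChain_integral_transitionKernel`) it is a Wiener integral of the
  jointly measurable `(t, z, ω) ↦ p_N(Φ_{t⁺}(z, B(ω)))` (`pinnedChain_measurable_uncurry_solMap`), and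
  parametric Bochner integrals are measurable (`StronglyMeasurable.integral_prod_right'`); hence
  `t ↦ S_N(t), r_N(t), P_N(t)` are measurable (Fubini measurability over the probability measure `μ_T`).
* `commonPastBound_fcast_even_moment`: `∫ v_t^{2m} dμ_T ≤ ∫ p_N^{2m} dμ_T = (2m−1)!!·T^m` (kernel
  Jensen + Gibbs invariance of `K_t`, `BondHeatUncertaintySubdiffusiveBondHeatKernelGibbsD`), in
  particular **`S_N(t) ≤ T`** (`commonPastBound_fnorm_le`) and `∫ v_t⁴ dμ_T ≤ 3T²`, uniformly in `N, t`.
* `commonPastBound_pairCorr_sq_le`: **`r_N(t)² ≤ T·S_N(t)`** (Cauchy–Schwarz, `‖p_0‖²_{L²(μ_T)} = T`).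

Real time is clamped at `0⁺` inside the vocabulary, so everything holds for all real `t`.
-/

noncomputable section

namespace Summit.AtomisticToContinuum.FouriersLaw.Theorems.PhononMeanFreePath

open MeasureTheory Set Filter Topology ProbabilityTheory
open scoped NNReal ENNReal
open Literature.MathematicalPhysics.KineticTheory.HeatConduction
open Literature.Probability.Process
open Summit.AtomisticToContinuum.FouriersLaw.Theorems.SubdiffusiveBondHeat
  (pinnedChain_integral_transitionKernel_gibbsMeasure)

/-! ### The mean forecast `v_t = K_t p_N`: joint measurability and Gibbs moments -/

section Forecast

variable {ω₂ lam β γ T : ℝ} (hω : 0 < ω₂) (hl : 0 ≤ lam) (hβ : 0 ≤ β) (hγ : 0 ≤ γ) (hT : 0 < T)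

include hω hl hβ hγ in
/-- **Joint measurability of the mean forecast** `(t, z) ↦ v_t(z) = (K_{t⁺} p_N)(z)`: by
`P^t g(x) = E g(Φ_t(x,B))` it is a Wiener integral of the jointly measurable map
`(t, z, ω) ↦ p_N(Φ_{t⁺}(z, B(ω)))`, and Bochner integrals depending measurably on a parameter are
measurable. [folklore] -/
theorem commonPastBound_measurable_fcast (N : ℕ) :
    Measurable fun p : ℝ × PhaseSpace (N + 1) => fcast ω₂ lam β γ T N p.1 p.2 := by
  set G : (ℝ × PhaseSpace (N + 1)) × WienerPair → ℝ := fun q =>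
    ((pinnedChain ω₂ lam β γ).solMap (N + 1) T T ((q.1.1.toNNReal : ℝ≥0) : ℝ) q.1.2 (pairPath q.2)).2
      (Fin.last N) with hG
  have hGm : Measurable G := by
    have h1 : Measurable fun q : (ℝ × PhaseSpace (N + 1)) × WienerPair =>
        (((q.1.1.toNNReal : ℝ≥0) : ℝ), (q.1.2, pairPath q.2)) :=
      (measurable_coe_nnreal_real.comp
        (measurable_real_toNNReal.comp (measurable_fst.comp measurable_fst))).prodMk
        ((measurable_snd.comp measurable_fst).prodMk (measurable_pairPath.comp measurable_snd))
    have h2 := (pinnedChain_measurable_uncurry_solMap hω hl hβ hγ (N + 1) T T).comp h1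
    have h3 : Measurable fun q : (ℝ × PhaseSpace (N + 1)) × WienerPair =>
        (pinnedChain ω₂ lam β γ).solMap (N + 1) T T ((q.1.1.toNNReal : ℝ≥0) : ℝ) q.1.2
          (pairPath q.2) := h2
    exact (measurable_pi_apply (Fin.last N)).comp (measurable_snd.comp h3)
  have hI : StronglyMeasurable fun x : ℝ × PhaseSpace (N + 1) => ∫ ω, G (x, ω) ∂wienerPair :=
    hGm.stronglyMeasurable.integral_prod_right'
  have heq : (fun p : ℝ × PhaseSpace (N + 1) => fcast ω₂ lam β γ T N p.1 p.2) =
      fun x => ∫ ω, G (x, ω) ∂wienerPair := by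
    funext x
    simp only [fcast, hG]
    exact pinnedChain_integral_transitionKernel hω hl hβ hγ (N + 1) T T _ _
      (by fun_prop : Continuous fun y : PhaseSpace (N + 1) => y.2 (Fin.last N)).aestronglyMeasurable
  rw [heq]
  exact hI.measurable

include hω hl hβ hγ in
/-- Measurability of `z ↦ v_t(z)` at fixed `t`. [folklore] -/
theorem commonPastBound_measurable_fcast_right (N : ℕ) (t : ℝ) :
    Measurable fun z : PhaseSpace (N + 1) => fcast ω₂ lam β γ T N t z := by
  have h : Measurable (Function.uncurry (fcast ω₂ lam β γ T N)) :=
    commonPastBound_measurable_fcast hω hl hβ hγ (T := T) N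
  exact h.of_uncurry_left

include hω hl hβ hγ hT in
/-- **Even Gibbs moments of the mean forecast are contracted**: `v_t^{2m} ∈ L¹(μ_T)` and
`∫ v_t^{2m} dμ_T ≤ ∫ p_N^{2m} dμ_T = (2m−1)!!·T^m` (kernel Jensen + Gibbs invariance of `K_t`),
uniformly in `N` and `t`. [folklore] -/
theorem commonPastBound_fcast_even_moment (N : ℕ) (t : ℝ) (m : ℕ) :
    Integrable (fun z => fcast ω₂ lam β γ T N t z ^ (2 * m))
        ((pinnedChain ω₂ lam β γ).gibbsMeasure (N + 1) T) ∧
      ∫ z, fcast ω₂ lam β γ T N t z ^ (2 * m) ∂((pinnedChain ω₂ lam β γ).gibbsMeasure (N + 1) T) ≤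
        T ^ m * ∏ j ∈ Finset.range m, (2 * (j : ℝ) + 1) := by
  have hN : 0 < N + 1 := Nat.succ_pos N
  have hg := commonPastBound_integrable_momentum_pow_gibbsMeasure hω hl hβ γ hT (Fin.last N) (2 * m)
  have hw := commonPastBound_integrable_integral_transitionKernel hω hl hβ hγ hN hT t.toNNReal hg
  have hpt : ∀ z, fcast ω₂ lam β γ T N t z ^ (2 * m) ≤ ∫ y, y.2 (Fin.last N) ^ (2 * m)
      ∂((pinnedChain ω₂ lam β γ).transitionKernel (N + 1) T T t.toNNReal z) := fun z =>
    commonPastBound_integral_momentum_pow_le hω hl hβ hγ hN hT t.toNNReal z (Fin.last N) m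
  have hint : Integrable (fun z => fcast ω₂ lam β γ T N t z ^ (2 * m))
      ((pinnedChain ω₂ lam β γ).gibbsMeasure (N + 1) T) := by
    refine hw.mono' ((commonPastBound_measurable_fcast_right hω hl hβ hγ N t).pow_const
      _).aestronglyMeasurable (Eventually.of_forall fun z => ?_)
    rw [Real.norm_of_nonneg (by rw [pow_mul]; positivity)]
    exact hpt z
  refine ⟨hint, (integral_mono hint hw hpt).trans ?_⟩
  rw [pinnedChain_integral_transitionKernel_gibbsMeasure hω hl hβ hγ hN hT _ hg,
    commonPastBound_gibbs_even_moment hω hl hβ γ hT (Fin.last N) m]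

include hω hl hβ hγ hT in
/-- `v_t² ∈ L¹(μ_T)` and the **forecast norm is bounded by the temperature**:
`S_N(t) = ∫ v_t² dμ_T ≤ ∫ p_N² dμ_T = T`, for all `N`, `t`. [folklore] -/
theorem commonPastBound_fnorm_le (N : ℕ) (t : ℝ) :
    Integrable (fun z => fcast ω₂ lam β γ T N t z ^ 2) ((pinnedChain ω₂ lam β γ).gibbsMeasure (N + 1) T) ∧
      fnorm ω₂ lam β γ T N t ≤ T := by
  have h := commonPastBound_fcast_even_moment hω hl hβ hγ hT N t 1
  simpa [fnorm] using h

include hω hl hβ hγ hT in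
/-- `v_t⁴ ∈ L¹(μ_T)` with `∫ v_t⁴ dμ_T ≤ 3T²`, for all `N`, `t`. [folklore] -/
theorem commonPastBound_fcast_fourth_moment (N : ℕ) (t : ℝ) :
    Integrable (fun z => fcast ω₂ lam β γ T N t z ^ 4) ((pinnedChain ω₂ lam β γ).gibbsMeasure (N + 1) T) ∧
      ∫ z, fcast ω₂ lam β γ T N t z ^ 4 ∂((pinnedChain ω₂ lam β γ).gibbsMeasure (N + 1) T) ≤
        3 * T ^ 2 := by
  have h := commonPastBound_fcast_even_moment hω hl hβ hγ hT N t 2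
  have e : T ^ 2 * ∏ j ∈ Finset.range 2, (2 * (j : ℝ) + 1) = 3 * T ^ 2 := by
    simp [Finset.prod_range_succ]; ring
  rw [e] at h
  exact h

/-! ### Measurability in `t` of the route objects -/

include hω hl hβ hγ hT in
/-- `t ↦ S_N(t)` is measurable. [folklore] -/
theorem commonPastBound_measurable_fnorm (N : ℕ) : Measurable (fnorm ω₂ lam β γ T N) := by
  haveI : IsProbabilityMeasure ((pinnedChain ω₂ lam β γ).gibbsMeasure (N + 1) T) :=
    pinnedChain_isProbabilityMeasure_gibbsMeasure hω hl hβ γ (N + 1) hT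
  have h := commonPastBound_measurable_fcast hω hl hβ hγ (T := T) N
  have h2 : StronglyMeasurable fun p : ℝ × PhaseSpace (N + 1) => fcast ω₂ lam β γ T N p.1 p.2 ^ 2 :=
    (h.pow_const 2).stronglyMeasurable
  exact (h2.integral_prod_right' (ν := (pinnedChain ω₂ lam β γ).gibbsMeasure (N + 1) T)).measurable

include hω hl hβ hγ hT in
/-- `t ↦ r_N(t)` is measurable. [folklore] -/
theorem commonPastBound_measurable_pairCorr (N : ℕ) : Measurable (pairCorr ω₂ lam β γ T N) := by
  haveI : IsProbabilityMeasure ((pinnedChain ω₂ lam β γ).gibbsMeasure (N + 1) T) :=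
    pinnedChain_isProbabilityMeasure_gibbsMeasure hω hl hβ γ (N + 1) hT
  have h := commonPastBound_measurable_fcast hω hl hβ hγ (T := T) N
  have hp : Measurable fun p : ℝ × PhaseSpace (N + 1) => p.2.2 0 :=
    (measurable_pi_apply 0).comp (measurable_snd.comp measurable_snd)
  have h2 : StronglyMeasurable fun p : ℝ × PhaseSpace (N + 1) =>
      p.2.2 0 * fcast ω₂ lam β γ T N p.1 p.2 := (hp.mul h).stronglyMeasurable
  exact (h2.integral_prod_right' (ν := (pinnedChain ω₂ lam β γ).gibbsMeasure (N + 1) T)).measurable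

include hω hl hβ hγ hT in
/-- `t ↦ P_N(t)` is measurable. [folklore] -/
theorem commonPastBound_measurable_commonPast (N : ℕ) : Measurable (commonPast ω₂ lam β γ T N) := by
  haveI : IsProbabilityMeasure ((pinnedChain ω₂ lam β γ).gibbsMeasure (N + 1) T) :=
    pinnedChain_isProbabilityMeasure_gibbsMeasure hω hl hβ γ (N + 1) hT
  have h := commonPastBound_measurable_fcast hω hl hβ hγ (T := T) N
  have hp : Measurable fun p : ℝ × PhaseSpace (N + 1) => p.2.2 0 :=
    (measurable_pi_apply 0).comp (measurable_snd.comp measurable_snd)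
  have h2 : StronglyMeasurable fun p : ℝ × PhaseSpace (N + 1) =>
      p.2.2 0 ^ 2 * fcast ω₂ lam β γ T N p.1 p.2 ^ 2 := ((hp.pow_const 2).mul (h.pow_const 2)).stronglyMeasurable
  have h3 : StronglyMeasurable fun p : ℝ × PhaseSpace (N + 1) => fcast ω₂ lam β γ T N p.1 p.2 ^ 2 :=
    (h.pow_const 2).stronglyMeasurable
  exact (h2.integral_prod_right' (ν := (pinnedChain ω₂ lam β γ).gibbsMeasure (N + 1) T)).measurable.sub
    ((h3.integral_prod_right'
      (ν := (pinnedChain ω₂ lam β γ).gibbsMeasure (N + 1) T)).measurable.const_mul _)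

/-! ### Cauchy–Schwarz: `r_N(t)² ≤ T·S_N(t)` -/

include hω hl hβ hγ hT in
/-- **`r_N(t)² ≤ T · S_N(t)`**: Cauchy–Schwarz in `L²(μ_T)` for `r_N = ⟨p_0, v_t⟩`, with
`‖p_0‖²_{L²(μ_T)} = T` exactly (equipartition); proved through the non-negativity of
`∫ (a p_0 − v_t)² dμ_T` at `a = r_N/T`. [folklore] -/
theorem commonPastBound_pairCorr_sq_le (N : ℕ) (t : ℝ) :
    pairCorr ω₂ lam β γ T N t ^ 2 ≤ T * fnorm ω₂ lam β γ T N t := by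
  set μ₀ := (pinnedChain ω₂ lam β γ).gibbsMeasure (N + 1) T with hμ₀
  set v : PhaseSpace (N + 1) → ℝ := fun z => fcast ω₂ lam β γ T N t z with hv
  have hvm : Measurable v := commonPastBound_measurable_fcast_right hω hl hβ hγ N t
  have hI1 : Integrable (fun z : PhaseSpace (N + 1) => z.2 0 ^ 2) μ₀ :=
    commonPastBound_integrable_momentum_pow_gibbsMeasure hω hl hβ γ hT 0 2
  have hI2 : Integrable (fun z => v z ^ 2) μ₀ := (commonPastBound_fnorm_le hω hl hβ hγ hT N t).1
  have hI3 : Integrable (fun z : PhaseSpace (N + 1) => z.2 0 * v z) μ₀ := by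
    refine ((hI1.add hI2).div_const 2).mono'
      (((measurable_pi_apply 0).comp measurable_snd).mul hvm).aestronglyMeasurable
      (Eventually.of_forall fun z => ?_)
    rw [Real.norm_eq_abs, abs_mul]
    have := two_mul_le_add_sq |z.2 0| |v z|
    rw [sq_abs, sq_abs] at this
    simp only [Pi.add_apply]
    linarith
  have hT1 : ∫ z : PhaseSpace (N + 1), z.2 0 ^ 2 ∂μ₀ = T := by
    have h := commonPastBound_gibbs_even_moment hω hl hβ γ hT (0 : Fin (N + 1)) 1
    simpa using h
  set r := pairCorr ω₂ lam β γ T N t with hr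
  set S := fnorm ω₂ lam β γ T N t with hS
  have hr' : r = ∫ z, z.2 0 * v z ∂μ₀ := rfl
  have hS' : S = ∫ z, v z ^ 2 ∂μ₀ := rfl
  have key : ∀ a : ℝ, 0 ≤ a ^ 2 * T - 2 * a * r + S := by
    intro a
    have hnn : 0 ≤ ∫ z, (a * z.2 0 - v z) ^ 2 ∂μ₀ := integral_nonneg fun z => sq_nonneg _
    have e : (fun z : PhaseSpace (N + 1) => (a * z.2 0 - v z) ^ 2) =
        fun z => (a ^ 2 * z.2 0 ^ 2 - 2 * a * (z.2 0 * v z)) + v z ^ 2 := by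
      funext z; ring
    have hA : Integrable (fun z : PhaseSpace (N + 1) => a ^ 2 * z.2 0 ^ 2 - 2 * a * (z.2 0 * v z)) μ₀ :=
      (hI1.const_mul _).sub (hI3.const_mul _)
    rw [e, integral_add hA hI2, integral_sub (hI1.const_mul _) (hI3.const_mul _), integral_const_mul,
      integral_const_mul, hT1, ← hr', ← hS'] at hnn
    exact hnn
  have h := key (r / T)
  have e : (r / T) ^ 2 * T - 2 * (r / T) * r + S = S - r ^ 2 / T := by
    field_simp
    ring
  rw [e, sub_nonneg, div_le_iff₀ hT] at h
  linarith

end Forecast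

/-! ### The registered helper statement -/

/-- **Registered helper `commonPastBound_forecastDictionary`** (for stub `stub_commonPastBound`, line
`two-horizons-forecast-loss`): for the pinned anharmonic chain with both baths at `T > 0` and every `N`:
`(t,z) ↦ v_t(z)` is jointly measurable; `t ↦ S_N(t)`, `t ↦ r_N(t)`, `t ↦ P_N(t)` are measurable; and
for every real `t`: `v_t² ∈ L¹(μ_T)` with `S_N(t) ≤ T`, `v_t⁴ ∈ L¹(μ_T)` with `∫ v_t⁴ dμ_T ≤ 3T²`,
and `r_N(t)² ≤ T·S_N(t)`. [folklore] -/
theorem commonPastBound_forecastDictionary : ∀ ω₂ lam β γ : ℝ, 0 < ω₂ → 0 ≤ lam → 0 ≤ β → 0 ≤ γ → ∀ T : ℝ, 0 < T → ∀ N : ℕ, Measurable (Function.uncurry (fcast ω₂ lam β γ T N)) ∧ Measurable (fnorm ω₂ lam β γ T N) ∧ Measurable (pairCorr ω₂ lam β γ T N) ∧ Measurable (commonPast ω₂ lam β γ T N) ∧ ∀ t : ℝ, Integrable (fun z => fcast ω₂ lam β γ T N t z ^ 2) ((pinnedChain ω₂ lam β γ).gibbsMeasure (N + 1) T) ∧ fnorm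 ω₂ lam β γ T N t ≤ T ∧ Integrable (fun z => fcast ω₂ lam β γ T N t z ^ 4) ((pinnedChain ω₂ lam β γ).gibbsMeasure (N + 1) T) ∧ ∫ z, fcast ω₂ lam β γ T N t z ^ 4 ∂((pinnedChain ω₂ lam β γ).gibbsMeasure (N + 1) T) ≤ 3 * T ^ 2 ∧ pairCorr ω₂ lam β γ T N t ^ 2 ≤ T * fnorm ω₂ lam β γ T N t := by
  intro ω₂ lam β γ hω hl hβ hγ T hT N
  refine ⟨commonPastBound_measurable_fcast hω hl hβ hγ N, commonPastBound_measurable_fnorm hω hl hβ hγ hT N,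
    commonPastBound_measurable_pairCorr hω hl hβ hγ hT N, commonPastBound_measurable_commonPast hω hl hβ hγ hT N,
    fun t => ⟨(commonPastBound_fnorm_le hω hl hβ hγ hT N t).1, (commonPastBound_fnorm_le hω hl hβ hγ hT N t).2,
      (commonPastBound_fcast_fourth_moment hω hl hβ hγ hT N t).1,
      (commonPastBound_fcast_fourth_moment hω hl hβ hγ hT N t).2,
      commonPastBound_pairCorr_sq_le hω hl hβ hγ hT N t⟩⟩

end Summit.AtomisticToContinuum.FouriersLaw.Theorems.PhononMeanFreePath

end
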